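import Summits.ResolutionOfSingularities.ResolutionOfSingularities.Theorems.HilbertSamuelEliminationSigmaMaxModificationsCorridor3WLadderStrataClean
import Literature.AlgebraicGeometry.CossartJannsenSaito2020.ProjDirProjectiveLine
import Literature.AlgebraicGeometry.CossartJannsenSaito2020.NearPointProjDirectrix
import Literature.AlgebraicGeometry.Resolution.PermissibleCentres
import Summits.ResolutionOfSingularities.ResolutionOfSingularities.Theorems.HilbertSamuelEliminationCampaignW42ProjDirectrixOfDirDimEq
import Literature.AlgebraicGeometry.Resolution.PointBlowupHilbertSamuelStrata
import HarnessLib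

/-!
# [OURS · L1 W4.2] ROW (K-ctr) AT `e = 2`, POINT-CENTRE CASE: the members of `X_{n+1}(ν)` through `x_{n+1}` over a blown-up
# POINT `x_n` with `e_{x_n}(X_n) = 2` lie on `ℙ(Dir_{x_n}(X_n)) ≅ ℙ¹_{k(x_n)}` — so they are `{x_{n+1}}` or the whole line,
# UNIQUE, and a regular curve at `x_{n+1}` (crux chain w42, RULINGS v3.13-3 «(K-ctr)@e=2», hand res-D-pv-038)

OURS (cell `res-hironaka`, slot W4.2, crux `stmt-ResolutionOfSingularities-18506` / conjunct `-19249`; `--supports … --as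
helper`, counted 0).  NOT a statement of the manuscript under review [claim: Hironaka2017, status: under-review] nor of
[CossartJannsenSaito2020]: the two printed inputs enter BY NAME as hypotheses — CJS Thm. 3.14 in its point-centre LOCUS form
(`Thm314_point_locus`, p503241: a point of `Bℓ_x(X)` near to `x` lies on `ℙ(Dir_x(X))`) and CJS Def. 6.38 (ii) / p. 105
«`C_1 = ℙ(Dir_x(X)) ≅ ℙ^1_{k(x)}`» in res-type-031's rendering `ProjDir_projLine` (p516003: `ℙ(Dir)` closed, irreducible,
non-generic points closed, reduced local rings regular).  AI plumbing, weaker than expert review; every `theorem` is PROVED.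

## What (the CONTENT of stub-4's row `Moving.StrataCentreMembersClean` at a point-centre step with `e = 2`, p516588)

Let `π : X′ ⟶ X` be the blow-up of a locally noetherian excellent `X` in a closed point `x` with `e_x(X) = 2` (centre
permissible, `dim X ≤ N`, (F1) `CharHypothesis X x`), `ν = H_X(x)`, and let `W = X′(ν)` be the `ν`-stratum of `X′`, CLOSED.
* `subset_projDirectrixFibre_of_subset_hsStratum` — a subset of `W` lying over `x` consists of near points, hence lies on
  `P = ℙ(Dir_x(X))` (Thm. 3.14);
* `eq_singleton_or_eq_projDir` — an irreducible closed `A ⊆ P` through a point `x′` is `{x′}` or `P` (`P ≅ ℙ¹`: its generic point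
  is the only non-closed point);
* `componentsThrough_overCentre_unique` — for a marked stage `s = (X′, x′)`: two members of `componentsThrough N ν s` mapping into
  `{x}` coincide (each is `{x′}` or `P`; components are maximal irreducible subsets);
* `isRegularCurveAt_of_overCentre` — such a member is `Moving.IsRegularCurveAt s` (for `{x′}`: `𝒪/𝔪` is a field; for `P`: the
  regular local rings of `ProjDir_projLine`, and the curve clause by `eq_singleton_or_eq_projDir`);
* `strataCentreMembersClean_pointCase` — both conclusions packaged in the shape of the two clauses of (K-ctr).

[cite: CossartJannsenSaito2020, Thm. 3.14, Def. 6.34 (i), Def. 6.38 (ii), p. 105]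
-/

noncomputable section

set_option linter.dupNamespace false -- mandated namespace `…ResolutionOfSingularities.ResolutionOfSingularities…` of this single-conjunct summit

open CategoryTheory AlgebraicGeometry TopologicalSpace Topology IsLocalRing
open Summit.ResolutionOfSingularities.ResolutionOfSingularities.Theorems.CampaignW42
open Literature.AlgebraicGeometry.Resolution Literature.RingTheory.HilbertSamuel
open Literature.AlgebraicGeometry.CossartJannsenSaito2020
open Summit.ResolutionOfSingularities.ResolutionOfSingularities.Theorems.SigmaMaxModificationsCorridor3

universe u

namespace Summit.ResolutionOfSingularities.ResolutionOfSingularities.Theorems.SigmaMaxModificationsCorridor3.Moving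

variable {N : ℕ} {ν : ℕ → ℕ}

/-! ## §1. Over a blown-up point, the stratum lies on `ℙ(Dir)` -/

/-- **Thm. 3.14 over the stratum**: a subset of the `ν`-stratum of `X′ = Bℓ_x(X)` lying over `x ∈ X(ν)` lies on `ℙ(Dir_x(X))`.
[cite: CossartJannsenSaito2020, Thm. 3.14] -/
theorem subset_projDirectrixFibre_of_subset_hsStratum (h314 : Thm314_point_locus.{u}) {X X' : Scheme.{u}}
    [IsLocallyNoetherian X] (π : X' ⟶ X) {x : X} (hx : IsClosed ({x} : Set X)) (hexc : Scheme.IsExcellent X)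
    (hperm : IdealSheafData.IsPermissible (Scheme.IdealSheafData.vanishingIdeal ⟨{x}, hx⟩))
    (hbl : IsBlowup π (Scheme.IdealSheafData.vanishingIdeal ⟨{x}, hx⟩))
    (hdim : topologicalKrullDim X ≤ (N : WithBot ℕ∞)) (hchar : CharHypothesis X x) (hν : Scheme.hsFun X N x = ν)
    {Z : Set X'} (hZW : Z ⊆ Scheme.hsStratum X' N ν) (hZx : π.base '' Z ⊆ {x}) :
    Z ⊆ projDirectrixFibre π x := by
  intro z hz
  have hπz : π.base z = x := hZx ⟨z, hz, rfl⟩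
  refine ⟨hπz, h314 X X' π x hx N z hexc hperm hbl hdim hπz hchar ?_⟩
  rw [hν]
  exact hZW hz

/-! ## §2. `ℙ(Dir) ≅ ℙ¹`: irreducible closed subsets through a point -/

/-- **An irreducible closed subset of `P = ℙ(Dir_x(X))` (`e_x(X) = 2`) through a point `x′` is `{x′}` or `P`** — the generic
point of `P` is its only non-closed point (`ProjDir_projLine`). [cite: CossartJannsenSaito2020, Def. 6.38 (ii), p. 105] -/
theorem eq_singleton_or_eq_projDir (hPa : ProjDir_projLine.{u}) {X X' : Scheme.{u}} [IsLocallyNoetherian X] (π : X' ⟶ X)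
    {x : X} (hx : IsClosed ({x} : Set X)) (hbl : IsBlowup π (Scheme.IdealSheafData.vanishingIdeal ⟨{x}, hx⟩))
    (he : Scheme.dirDim X x = 2) {A : Set X'} (hA : IsIrreducible A) (hAc : IsClosed A)
    (hAP : A ⊆ projDirectrixFibre π x) {x' : X'} (hx'A : x' ∈ A) :
    A = {x'} ∨ A = projDirectrixFibre π x := by
  obtain ⟨-, -, -, hclosed, -⟩ := hPa X X' π x hx hbl he
  obtain ⟨a, ha⟩ := QuasiSober.sober hA hAc
  have haA : a ∈ A := ha.mem
  by_cases hgen : IsGenericPoint a (projDirectrixFibre π x)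
  · right
    rw [← ha.def, ← hgen.def]
  · left
    have hacl : IsClosed ({a} : Set X') := hclosed a (hAP haA) hgen
    have hAa : A = {a} := by rw [← ha.def, hacl.closure_eq]
    rw [hAa] at hx'A
    rw [hAa, Set.mem_singleton_iff.1 hx'A]

/-! ## §3. The two clauses of (K-ctr) at a point-centre step with `e = 2` -/

section PointCentre

/-- A member of `componentsThrough N ν s` lying over the blown-up point `x` is `{x_{n+1}}` or `ℙ(Dir_x(X))`.
[cite: CossartJannsenSaito2020, Thm. 3.14, Def. 6.38 (ii)] -/
theorem componentsThrough_overCentre_eq (hPa : ProjDir_projLine.{u}) (h314 : Thm314_point_locus.{u})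
    {X : Scheme.{u}} [IsLocallyNoetherian X] (s : MarkedStage.{u}) (π : s.W ⟶ X) {x : X}
    (hx : IsClosed ({x} : Set X)) (hexc : Scheme.IsExcellent X)
    (hperm : IdealSheafData.IsPermissible (Scheme.IdealSheafData.vanishingIdeal ⟨{x}, hx⟩))
    (hbl : IsBlowup π (Scheme.IdealSheafData.vanishingIdeal ⟨{x}, hx⟩))
    (hdim : topologicalKrullDim X ≤ (N : WithBot ℕ∞)) (hchar : CharHypothesis X x) (hν : Scheme.hsFun X N x = ν)
    (he : Scheme.dirDim X x = 2) (hWc : IsClosed (Scheme.hsStratum s.W N ν))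
    {Z : Set s.W} (hZ : Z ∈ componentsThrough N ν s) (hZx : π.base '' Z ⊆ {x}) :
    Z = {s.pt} ∨ Z = projDirectrixFibre π x := by
  have hZc : IsClosed Z := componentsIn.isClosed hWc hZ.1
  exact eq_singleton_or_eq_projDir hPa π hx hbl he (componentsIn.isIrreducible hZ.1) hZc
    (subset_projDirectrixFibre_of_subset_hsStratum h314 π hx hexc hperm hbl hdim hchar hν (componentsIn.subset hZ.1) hZx)
    hZ.2

/-- **(K-ctr), first clause, point-centre case**: two members of `componentsThrough N ν s` over the blown-up point coincide.
[cite: CossartJannsenSaito2020, Thm. 3.14, Def. 6.38 (ii)] -/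
theorem componentsThrough_overCentre_unique (hPa : ProjDir_projLine.{u}) (h314 : Thm314_point_locus.{u})
    {X : Scheme.{u}} [IsLocallyNoetherian X] (s : MarkedStage.{u}) (π : s.W ⟶ X) {x : X}
    (hx : IsClosed ({x} : Set X)) (hexc : Scheme.IsExcellent X)
    (hperm : IdealSheafData.IsPermissible (Scheme.IdealSheafData.vanishingIdeal ⟨{x}, hx⟩))
    (hbl : IsBlowup π (Scheme.IdealSheafData.vanishingIdeal ⟨{x}, hx⟩))
    (hdim : topologicalKrullDim X ≤ (N : WithBot ℕ∞)) (hchar : CharHypothesis X x) (hν : Scheme.hsFun X N x = ν)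
    (he : Scheme.dirDim X x = 2) (hWc : IsClosed (Scheme.hsStratum s.W N ν))
    {Z Z' : Set s.W} (hZ : Z ∈ componentsThrough N ν s)
    (hZ' : Z' ∈ componentsThrough N ν s) (hZx : π.base '' Z ⊆ {x}) (hZ'x : π.base '' Z' ⊆ {x}) : Z = Z' := by
  -- both are `{x′}` or `P`; components of the stratum are maximal irreducible subsets
  have hmax : ∀ {A B : Set s.W}, A ∈ componentsThrough N ν s → B ∈ componentsThrough N ν s → A ⊆ B → A = B :=
    fun hA hB hAB => Set.Subset.antisymm hAB
      ((mem_componentsIn_iff.1 hA.1).2.2 _ (componentsIn.subset hB.1) (componentsIn.isIrreducible hB.1) hAB)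
  rcases componentsThrough_overCentre_eq hPa h314 s π hx hexc hperm hbl hdim hchar hν he hWc hZ hZx with h1 | h1 <;>
    rcases componentsThrough_overCentre_eq hPa h314 s π hx hexc hperm hbl hdim hchar hν he hWc hZ' hZ'x with h2 | h2
  · rw [h1, h2]
  · exact hmax hZ hZ' (by rw [h1]; exact Set.singleton_subset_iff.2 hZ'.2)
  · exact (hmax hZ' hZ (by rw [h2]; exact Set.singleton_subset_iff.2 hZ.2)).symm
  · rw [h1, h2]

/-- **(K-ctr), second clause, point-centre case**: a member of `componentsThrough N ν s` over the blown-up point is a regular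
curve at the marked point — `{x_{n+1}}` (its reduced local ring is the residue field) or `ℙ(Dir_x(X)) ≅ ℙ¹_{k(x)}` (regular by
`ProjDir_projLine`; its irreducible closed subsets through `x_{n+1}` are `{x_{n+1}}` and itself).
[cite: CossartJannsenSaito2020, Def. 6.38 (ii), p. 105] -/
theorem isRegularCurveAt_of_overCentre (hPa : ProjDir_projLine.{u}) (h314 : Thm314_point_locus.{u})
    {X : Scheme.{u}} [IsLocallyNoetherian X] (s : MarkedStage.{u}) (π : s.W ⟶ X) {x : X}
    (hx : IsClosed ({x} : Set X)) (hexc : Scheme.IsExcellent X)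
    (hperm : IdealSheafData.IsPermissible (Scheme.IdealSheafData.vanishingIdeal ⟨{x}, hx⟩))
    (hbl : IsBlowup π (Scheme.IdealSheafData.vanishingIdeal ⟨{x}, hx⟩))
    (hdim : topologicalKrullDim X ≤ (N : WithBot ℕ∞)) (hchar : CharHypothesis X x) (hν : Scheme.hsFun X N x = ν)
    (he : Scheme.dirDim X x = 2) (hWc : IsClosed (Scheme.hsStratum s.W N ν))
    {Z : Set s.W} (hZ : Z ∈ componentsThrough N ν s) (hZx : π.base '' Z ⊆ {x}) :
    IsRegularCurveAt s Z := by
  haveI : IsLocallyNoetherian s.W := s.ln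
  rcases componentsThrough_overCentre_eq hPa h314 s π hx hexc hperm hbl hdim hchar hν he hWc hZ hZx with rfl | rfl
  · -- `Z = {x′}`: the reduced local ring is the residue field
    refine ⟨Set.mem_singleton _, fun hZc => ?_, fun A _ _ hptA hAZ => Or.inl ?_⟩
    · rw [stalkIdeal_vanishingIdeal_singleton hZc]
      haveI : (maximalIdeal (s.W.presheaf.stalk s.pt)).IsMaximal := maximalIdeal.isMaximal _
      letI : Field (s.W.presheaf.stalk s.pt ⧸ maximalIdeal (s.W.presheaf.stalk s.pt)) := Ideal.Quotient.field _
      infer_instance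
    · exact Set.Subset.antisymm hAZ (Set.singleton_subset_iff.2 hptA)
  · -- `Z = ℙ(Dir_x(X)) ≅ ℙ¹`
    obtain ⟨hPc, -, -, -, hreg⟩ := hPa X s.W π x hx hbl he
    refine ⟨hZ.2, fun hZc => (hreg hZc s.pt hZ.2).1, fun A hA hAc hptA hAZ => ?_⟩
    exact eq_singleton_or_eq_projDir hPa π hx hbl he hA hAc hAZ hptA

/-- **(K-ctr) AT A POINT-CENTRE STEP WITH `e = 2` — both clauses in the row's shape**: over the blown-up point the members of
`componentsThrough N ν s` (marked stage `s = (X′, x_{n+1})`) mapping into `{x}` number at most one, and each is a regular curve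
at the marked point.  Printed inputs BY NAME: `Thm314_point_locus` (CJS Thm. 3.14, point-centre locus form) and
`ProjDir_projLine` (CJS Def. 6.38 (ii): `ℙ(Dir_x) ≅ ℙ¹_{k(x)}` at `e = 2`). [cite: CossartJannsenSaito2020, Thm. 3.14, Def. 6.38 (ii)] -/
theorem strataCentreMembersClean_pointCase (hPa : ProjDir_projLine.{u}) (h314 : Thm314_point_locus.{u})
    {X : Scheme.{u}} [IsLocallyNoetherian X] (s : MarkedStage.{u}) (π : s.W ⟶ X) {x : X}
    (hx : IsClosed ({x} : Set X)) (hexc : Scheme.IsExcellent X)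
    (hperm : IdealSheafData.IsPermissible (Scheme.IdealSheafData.vanishingIdeal ⟨{x}, hx⟩))
    (hbl : IsBlowup π (Scheme.IdealSheafData.vanishingIdeal ⟨{x}, hx⟩))
    (hdim : topologicalKrullDim X ≤ (N : WithBot ℕ∞)) (hchar : CharHypothesis X x) (hν : Scheme.hsFun X N x = ν)
    (he : Scheme.dirDim X x = 2) (hWc : IsClosed (Scheme.hsStratum s.W N ν))
    :
    (∀ Z ∈ componentsThrough N ν s, ∀ Z' ∈ componentsThrough N ν s,
        π.base '' Z ⊆ {x} → π.base '' Z' ⊆ {x} → Z = Z') ∧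
      ∀ Z ∈ componentsThrough N ν s, π.base '' Z ⊆ {x} → IsRegularCurveAt s Z :=
  ⟨fun _ hZ _ hZ' hZx hZ'x => componentsThrough_overCentre_unique hPa h314 s π hx hexc hperm hbl hdim hchar hν he hWc hZ hZ' hZx hZ'x,
    fun _ hZ hZx => isRegularCurveAt_of_overCentre hPa h314 s π hx hexc hperm hbl hdim hchar hν he hWc hZ hZx⟩

end PointCentre

/-! ## §4. The same with the `e = ē` door in place of (F1) (rev 2)

At a point `x` with `e_x(X) = ē_x(X)` (CJS (F3)) the point-centre locus form of Thm. 3.14 holds in EVERY characteristic and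
fact-free: res-L1-s42-pv-1's `CampaignW42.isOnProjDirectrix_of_isNearPoint_of_dirDim_eq_geomDirDim` (p518570).  So the
(F1) binder `CharHypothesis` and the named fact `Thm314_point_locus` of §§1–3 can be traded for `e_x(X) = ē_x(X)`;
`ProjDir_projLine` stays. -/

section DirDimEq

/-- **Over the stratum, onto `ℙ(Dir)`, `e = ē` door**: a subset of the `ν`-stratum of `X′ = Bℓ_x(X)` lying over `x ∈ X(ν)` with
`e_x(X) = ē_x(X)` lies on `ℙ(Dir_x(X))` — every characteristic, no named fact (s42-pv-1 p518570).
[cite: CossartJannsenSaito2020, Thm. 3.14, Thm. 3.10 (4)] -/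
theorem subset_projDirectrixFibre_of_subset_hsStratum_of_dirDim_eq_geomDirDim {X X' : Scheme.{u}}
    [IsLocallyNoetherian X] (π : X' ⟶ X) {x : X} (hx : IsClosed ({x} : Set X)) (hexc : Scheme.IsExcellent X)
    (hperm : IdealSheafData.IsPermissible (Scheme.IdealSheafData.vanishingIdeal ⟨{x}, hx⟩))
    (hbl : IsBlowup π (Scheme.IdealSheafData.vanishingIdeal ⟨{x}, hx⟩))
    (hee : Scheme.dirDim X x = Scheme.geomDirDim X x) (hν : Scheme.hsFun X N x = ν)
    {Z : Set X'} (hZW : Z ⊆ Scheme.hsStratum X' N ν) (hZx : π.base '' Z ⊆ {x}) :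
    Z ⊆ projDirectrixFibre π x := by
  intro z hz
  have hπz : π.base z = x := hZx ⟨z, hz, rfl⟩
  refine ⟨hπz, ?_⟩
  subst hπz
  have hsupp : π.base z ∈ (Scheme.IdealSheafData.vanishingIdeal (⟨{π.base z}, hx⟩ : Closeds X)).support := by
    rw [← SetLike.mem_coe, Scheme.IdealSheafData.coe_support_vanishingIdeal]
    exact Set.mem_singleton _
  refine isOnProjDirectrix_of_isNearPoint_of_dirDim_eq_geomDirDim hbl z (hperm _ hsupp)
    (hexc.isUniversallyCatenaryRing_stalk _) (stalkIdeal_vanishingIdeal_singleton hx) hee (N := N) ?_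
  show Scheme.hsFun X' N z = Scheme.hsFun X N (π.base z)
  rw [hν]
  exact hZW hz

/-- `e = ē` door: a member of `componentsThrough N ν s` over the blown-up point is `{x_{n+1}}` or `ℙ(Dir_x(X))`.
[cite: CossartJannsenSaito2020, Thm. 3.14, Def. 6.38 (ii)] -/
theorem componentsThrough_overCentre_eq_of_dirDim_eq_geomDirDim (hPa : ProjDir_projLine.{u})
    {X : Scheme.{u}} [IsLocallyNoetherian X] (s : MarkedStage.{u}) (π : s.W ⟶ X) {x : X}
    (hx : IsClosed ({x} : Set X)) (hexc : Scheme.IsExcellent X)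
    (hperm : IdealSheafData.IsPermissible (Scheme.IdealSheafData.vanishingIdeal ⟨{x}, hx⟩))
    (hbl : IsBlowup π (Scheme.IdealSheafData.vanishingIdeal ⟨{x}, hx⟩)) (hν : Scheme.hsFun X N x = ν)
    (he : Scheme.dirDim X x = 2) (hee : Scheme.dirDim X x = Scheme.geomDirDim X x)
    (hWc : IsClosed (Scheme.hsStratum s.W N ν))
    {Z : Set s.W} (hZ : Z ∈ componentsThrough N ν s) (hZx : π.base '' Z ⊆ {x}) :
    Z = {s.pt} ∨ Z = projDirectrixFibre π x :=
  eq_singleton_or_eq_projDir hPa π hx hbl he (componentsIn.isIrreducible hZ.1) (componentsIn.isClosed hWc hZ.1)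
    (subset_projDirectrixFibre_of_subset_hsStratum_of_dirDim_eq_geomDirDim π hx hexc hperm hbl hee hν
      (componentsIn.subset hZ.1) hZx) hZ.2

/-- **(K-ctr) AT A POINT-CENTRE STEP WITH `e = ē = 2`, every characteristic** (no (F1), no `Thm314_point_locus`; only the
printed `ProjDir_projLine` by name): both clauses of the row. [cite: CossartJannsenSaito2020, Thm. 3.14, Def. 6.38 (ii)] -/
theorem strataCentreMembersClean_pointCase_of_dirDim_eq_geomDirDim (hPa : ProjDir_projLine.{u})
    {X : Scheme.{u}} [IsLocallyNoetherian X] (s : MarkedStage.{u}) (π : s.W ⟶ X) {x : X}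
    (hx : IsClosed ({x} : Set X)) (hexc : Scheme.IsExcellent X)
    (hperm : IdealSheafData.IsPermissible (Scheme.IdealSheafData.vanishingIdeal ⟨{x}, hx⟩))
    (hbl : IsBlowup π (Scheme.IdealSheafData.vanishingIdeal ⟨{x}, hx⟩)) (hν : Scheme.hsFun X N x = ν)
    (he : Scheme.dirDim X x = 2) (hee : Scheme.dirDim X x = Scheme.geomDirDim X x)
    (hWc : IsClosed (Scheme.hsStratum s.W N ν)) :
    (∀ Z ∈ componentsThrough N ν s, ∀ Z' ∈ componentsThrough N ν s,
        π.base '' Z ⊆ {x} → π.base '' Z' ⊆ {x} → Z = Z') ∧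
      ∀ Z ∈ componentsThrough N ν s, π.base '' Z ⊆ {x} → IsRegularCurveAt s Z := by
  haveI : IsLocallyNoetherian s.W := s.ln
  have hcase : ∀ {Z : Set s.W}, Z ∈ componentsThrough N ν s → π.base '' Z ⊆ {x} →
      Z = {s.pt} ∨ Z = projDirectrixFibre π x := fun hZ hZx =>
    componentsThrough_overCentre_eq_of_dirDim_eq_geomDirDim hPa s π hx hexc hperm hbl hν he hee hWc hZ hZx
  have hmax : ∀ {A B : Set s.W}, A ∈ componentsThrough N ν s → B ∈ componentsThrough N ν s → A ⊆ B → A = B :=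
    fun hA hB hAB => Set.Subset.antisymm hAB
      ((mem_componentsIn_iff.1 hA.1).2.2 _ (componentsIn.subset hB.1) (componentsIn.isIrreducible hB.1) hAB)
  refine ⟨fun Z hZ Z' hZ' hZx hZ'x => ?_, fun Z hZ hZx => ?_⟩
  · rcases hcase hZ hZx with h1 | h1 <;> rcases hcase hZ' hZ'x with h2 | h2
    · rw [h1, h2]
    · exact hmax hZ hZ' (by rw [h1]; exact Set.singleton_subset_iff.2 hZ'.2)
    · exact (hmax hZ' hZ (by rw [h2]; exact Set.singleton_subset_iff.2 hZ.2)).symm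
    · rw [h1, h2]
  · rcases hcase hZ hZx with rfl | rfl
    · refine ⟨Set.mem_singleton _, fun hZc => ?_, fun A _ _ hptA hAZ => Or.inl ?_⟩
      · rw [stalkIdeal_vanishingIdeal_singleton hZc]
        haveI : (maximalIdeal (s.W.presheaf.stalk s.pt)).IsMaximal := maximalIdeal.isMaximal _
        letI : Field (s.W.presheaf.stalk s.pt ⧸ maximalIdeal (s.W.presheaf.stalk s.pt)) := Ideal.Quotient.field _
        infer_instance
      · exact Set.Subset.antisymm hAZ (Set.singleton_subset_iff.2 hptA)
    · obtain ⟨hPc, -, -, -, hreg⟩ := hPa X s.W π x hx hbl he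
      refine ⟨hZ.2, fun hZc => (hreg hZc s.pt hZ.2).1, fun A hA hAc hptA hAZ => ?_⟩
      exact eq_singleton_or_eq_projDir hPa π hx hbl he hA hAc hAZ hptA

end DirDimEq

end Summit.ResolutionOfSingularities.ResolutionOfSingularities.Theorems.SigmaMaxModificationsCorridor3.Moving

end
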